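import Mathlib
import HarnessLib
import Summits.HubbardSuperconductivity.HubbardSuperconductivity.Theorems.KLProgrammeKLRegimeEngineTowerLevBaseFWgrid
import Summits.HubbardSuperconductivity.HubbardSuperconductivity.Theorems.KLProgrammeKLRegimeEngineTowerLevReadoutFit

/-!
# Route `KLProgramme` — crux K3 ENGINE (stmt-HubbardSuperconductivity-20437 `KLRegimeEngineV17F2`), stub (b) v2, THE LEVELS PACKAGE (ℓ), located item
# «(ℓ)-READOUT-F» piece RO-3 (structure): THE LEVELS BELOW THE TOWER (`j < d`, and in fact ANY level `j`) READ STRAIGHT FROM p3's WEIGHTED GRID STEP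
# AT `(Λ_j, F_j)` — `KernelNormsLevels`' right-hand side at level `j` modulo the grid-step data at `(Λ_j, F_j)` and a `CE` threshold
# (cell gate-hubbard-kl, seat hubbard-kl-k3c3-p2 g16; the `(j, j)` twin of …TowerLevBaseFWgrid / …TowerLevBaseFDisc §1 (k3c3-p2 g15) ∘ …TowerLevReadoutFit §3)

WHY.  The re-based floor-keyed tower starts at `𝒱_d`; the levels `j < d` (block `0`) are never block inputs, and RO-1/RO-4 read out only `j ≥ d`.  But the action
at ANY cutoff `Λ_j` analysed by ANY family is ONE decay-weighted determinant-bounded integration of all fields above `Λ_j` from the grid vertex (p3 g20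
`klWtPinnedSumAt_klEffectiveAction_fam_le_of_wgridStep`, `(n, J) := (j, j)`): its bi-graded degree budget (`wgridBudget_bigraded_le`) dominates every levelled norm
(`klLevNormOf_le_of_wtPinned`), reads through the floor unit at `J = j` (`gridLaw_div_klLevUnitF_le`) with the regime discount `|U|^{p−1} ≤ λ^{p−1}/(B·Klam)²`
(`pow_le_pow_div_sq`), and the floor units row (`readoutLev_le_levelsRHS`) turns the result into the registered right-hand side:

* **`uvLevF_le_levelsRHS_of_wgridStep`** — under p3's weighted grid-step hypotheses at the cutoff `Λ_j`, analysis family `F_j`, rate `jw` (Gram `κ`, weighted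
  rows/columns `α_w`, radius `ρ` with `θ_w < 1`, weighted analysis-overlap rows/columns `c_r, c_c > 0` — the base binders of `…_of_wgridStep` with `(d, d−1) ↦ (j, j)`),
  the derived constants `(nV, c_F, c_g, A_g, P_g)` (equational), `1 ≤ B`, `λ = B·ε_j`, and the threshold `CE ≥ (Q_uv·ε_x²)·B·max 1 (A_uv/ε_x)` with
  `A_uv = 2^{7j}·A_g/Klam²/B²`, `Q_uv = P_g/8^j` (equational): for every track `t`, `3 ≤ p` and EVERY prescription `Ωe` at `F_j` (any level count —
  the weighted pinned budget dominates every prescription; the consumer picks `t` with `levelGainExp (t+1) = levelGainExp (levelCount Ωe)`),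
  `klLevNormOf … j (2p) 𝒱_j Ωe ≤ CE^p·ε_j^{p−1}·2^{(3p−5)j}·((2^j)⁻¹)^{levelGainExp (t+1)}`.
* **`kernelNormsLevels_uvF_of_wgridStep`** (§2, RO-3's CLOSER) — under the same binders with the threshold at `Qe.CE`: `KernelNormsLevels L M P Qe β U μ K j`
  (read every prescription on the track `t = 4`, whose exponent `levelGainExp 5 = 2` dominates `levelGainExp F ≤ 2`; no degree cap, no six-leg cell, no
  track bookkeeping).
No degree cap and no numerics are needed here (one step, no induction).  The data binders are the E1/base-data class at `(Λ_j, F_j)`.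
Compositions of landed theorems and real algebra; nothing about the model is asserted beyond them; nothing asserts (ℓ), any stub, K3 or superconductivity.
References: BGM 2006 §2.3 (2.13)–(2.14), §2.8 (2.83), §3 (3.2)–(3.8), Lemma 2.5 (2.98) [cite: BenfattoGiulianiMastropietro2006]; Pedra–Salmhofer 2008 Thm 2.4
[cite: PedraSalmhofer2008].
-/

noncomputable section

namespace Summit.HubbardSuperconductivity.HubbardSuperconductivity.Theorems.EngineV8

set_option linter.dupNamespace false -- summit = problem name (single-conjunct summit), D-0017

open Classical
open Real Finset Literature.MathematicalPhysics.QuantumLattice Literature.Probability.LatticeModels GrassmannAlgebra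
open Literature.Probability.LatticeModels.BattleFederbush
open Literature.MathematicalPhysics.QuantumLattice.FermiRG
open Summit.HubbardSuperconductivity.HubbardSuperconductivity.Theorems.KLProgrammeLegKernels
open Summit.HubbardSuperconductivity.HubbardSuperconductivity.Theorems.KLRegimeSplit
open Summit.HubbardSuperconductivity.HubbardSuperconductivity.Theorems.KLRegimeWick
open Summit.HubbardSuperconductivity.HubbardSuperconductivity.Theorems.TorusFourierL2
open Summit.HubbardSuperconductivity.HubbardSuperconductivity.Theorems.DispersionFlow

variable {L M : ℕ} [NeZero L] [NeZero M]

/-- **THE LEVELLED NORMS OF `𝒱_j` AT ITS OWN FAMILY `F_j` FROM p3's WEIGHTED GRID STEP AT `(Λ_j, F_j)`, BELOW `KernelNormsLevels`' RIGHT-HAND SIDE** (any level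
`j`; see the module docstring for the binders). [cite: BenfattoGiulianiMastropietro2006, §2.8 (2.83), §3 (3.2)-(3.8), Lemma 2.5 (2.98)] -/
theorem uvLevF_le_levelsRHS_of_wgridStep {β : ℝ} (hβ : 0 < β) {P : SplitConsts} (hP : P.WF) (U : ℝ) (hU : 0 < U) (μ : ℝ) (K : TrigPolyC4v) (j : ℕ)
    {B : ℝ} (hB : 1 ≤ B)
    -- p3's weighted grid step hypotheses at the cutoff `Λ_j`, analysis family `F_j`, rate `jw`
    (jw : ℕ) {κ : ℝ} (hκ : 0 < κ)
    (hGB : IsGramBoundedR ((hubbardGridSub L M β (2 * (2 * M))).transpose * hubbardCovAboveCT L M β μ 0 K (klScale klE0 j) *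
      hubbardGridSub L M β (2 * (2 * M))) κ)
    {αw : ℝ} (hαw : 0 < αw)
    (hrow : ∀ X, ∑ Y, ‖((hubbardGridSub L M β (2 * (2 * M))).transpose * hubbardCovAboveCT L M β μ 0 K (klScale klE0 j) *
      hubbardGridSub L M β (2 * (2 * M))) X Y‖ * gridLabelWt L (2 * (2 * M)) β {gridLegPos X, gridLegPos Y} ≤ αw)
    (hcol : ∀ Y, ∑ X, ‖((hubbardGridSub L M β (2 * (2 * M))).transpose * hubbardCovAboveCT L M β μ 0 K (klScale klE0 j) *
      hubbardGridSub L M β (2 * (2 * M))) X Y‖ * gridLabelWt L (2 * (2 * M)) β {gridLegPos X, gridLegPos Y} ≤ αw)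
    {ρ : ℝ} (hρ : 0 < ρ)
    (hθ : Real.exp 1 * αw * normV (GridLeg (GridPoint L (2 * (2 * M)))) κ ρ
      (fun m' : ℕ => if m' = 1 then |β| / (2 * (2 * M) : ℕ) * ∑ z : TorusSite 2 L, ‖framePosKernel L K z‖ * (1 + torusSiteDist z 0)
        else if m' = 2 then |U| * |β| / (2 * (2 * M) : ℕ) else 0) / κ ^ 2 < 1)
    {crw ccw : ℝ} (hcrw : 0 < crw) (hccw : 0 < ccw)
    (hrow' : ∀ X'' : SpaceTimeIdx L M × SectorLeg (sectorCount j), ∑ X' : GridLeg (GridPoint L (2 * (2 * M))),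
      ‖(sectorAnalysisMatrix L M β (klAnisoFamily L M β μ K klE0 j) * hubbardGridSub L M β (2 * (2 * M))) X'' X'‖ *
        gridLabelWt L (2 * (2 * M)) β {latticeLegPos (2 * (2 * M)) X'', gridLegPos X'} ≤ crw)
    (hcol' : ∀ X' : GridLeg (GridPoint L (2 * (2 * M))), ∑ X'' : SpaceTimeIdx L M × SectorLeg (sectorCount j),
      ‖(sectorAnalysisMatrix L M β (klAnisoFamily L M β μ K klE0 j) * hubbardGridSub L M β (2 * (2 * M))) X'' X'‖ *
        gridLabelWt L (2 * (2 * M)) β {latticeLegPos (2 * (2 * M)) X'', gridLegPos X'} ≤ ccw)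
    -- the derived constants (equational binders)
    {nV cF cg Ag Pg : ℝ}
    (hnV : nV = normV (GridLeg (GridPoint L (2 * (2 * M)))) κ ρ
      (fun m' : ℕ => if m' = 1 then |β| / (2 * (2 * M) : ℕ) * ∑ z : TorusSite 2 L, ‖framePosKernel L K z‖ * (1 + torusSiteDist z 0)
        else if m' = 2 then |U| * |β| / (2 * (2 * M) : ℕ) else 0))
    (hcF : cF = (Real.exp 2 * (κ + ρ)) ^ (2 * 2) * (|β| / (2 * (2 * M) : ℕ))) (hcg : cg = Real.exp 1 * αw * cF / κ ^ 2)
    (hAg : Ag = crw * Real.exp 1 * cF / (ccw * cg ^ 2)) (hPg : Pg = ccw ^ 2 * cg / (ρ ^ 2 * (1 - Real.exp 1 * αw * nV / κ ^ 2)))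
    -- the UV read-out constants (equational) and the threshold
    {Auv Quv CE : ℝ} (hAuv : Auv = (2 : ℝ) ^ (7 * j) * Ag / P.Klam ^ 2 / B ^ 2) (hQuv : Quv = Pg / (8 : ℝ) ^ j)
    (hCE : Quv * imagTimeWeight β M ^ 2 * B * max 1 (Auv / imagTimeWeight β M) ≤ CE)
    (t : Fin 5) {p : ℕ} (hp : 3 ≤ p) (Ωe : Fin (2 * p) → Option (SectorLeg (sectorCount j))) :
    klLevNormOf L M β μ K j (2 * p) (klEffectiveAction L M β U μ K klE0 j) Ωe ≤
      CE ^ p * epsCoupling P U j ^ (p - 1) * (2 : ℝ) ^ ((3 * (p : ℤ) - 5) * j) * (((2 : ℝ) ^ j)⁻¹) ^ levelGainExp ((t : ℕ) + 1) := by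
  have hε : 0 ≤ imagTimeWeight β M := imagTimeWeight_nonneg hβ.le M
  have hK1 : 1 ≤ P.Klam := hP.1
  have hK0 : 0 < P.Klam := lt_of_lt_of_le one_pos hK1
  have hB0 : 0 < B := lt_of_lt_of_le one_pos hB
  have hBK : 1 ≤ B * P.Klam := one_le_mul_of_one_le_of_one_le hB hK1
  have hεj : 0 < epsCoupling P U j := by
    unfold epsCoupling
    have : 0 < |U| + U ^ 2 * (j : ℝ) := by positivity
    positivity
  set lam : ℝ := B * epsCoupling P U j with hlamdef
  have hlam : 0 < lam := mul_pos hB0 hεj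
  have hle : B * P.Klam * |U| ≤ lam := by
    rw [hlamdef]
    unfold epsCoupling
    have h1 : |U| ≤ |U| + U ^ 2 * (j : ℝ) := le_add_of_nonneg_right (by positivity)
    calc B * P.Klam * |U| = B * (P.Klam * |U|) := by ring
      _ ≤ B * (P.Klam * (|U| + U ^ 2 * (j : ℝ))) := mul_le_mul_of_nonneg_left (mul_le_mul_of_nonneg_left h1 hK0.le) hB0.le
  -- the profile norm, the budget and its bi-graded reading (verbatim as …TowerLevBaseFWgrid, at `(j, j)`)
  have hMpos : (0 : ℝ) < (2 * (2 * M) : ℕ) := by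
    have := NeZero.ne M
    exact_mod_cast (by omega : 0 < 2 * (2 * M))
  have hθ' : Real.exp 1 * αw * nV / κ ^ 2 < 1 := by rw [hnV]; exact hθ
  set f : ℝ := (Real.exp 2 * (κ + ρ)) ^ (2 * 2) * (|U| * |β| / (2 * (2 * M) : ℕ)) with hfdef
  have hcF0 : 0 < cF := by rw [hcF]; have := abs_pos.2 hβ.ne'; positivity
  have hfu : f = cF * |U| := by rw [hfdef, hcF]; ring
  have h1θ : 0 < 1 - Real.exp 1 * αw * nV / κ ^ 2 := sub_pos.2 hθ'
  obtain ⟨Nlit, hNlit⟩ : ∃ Nlit : ℕ → ℝ, Nlit = fun m =>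
      if m = 2 then imagTimeWeight β M ^ (2 - 1) * (crw * ccw ^ (2 - 1) * (ρ⁻¹ ^ 2 * (Real.exp 1 * nV) / (1 - Real.exp 1 * αw * nV / κ ^ 2)))
      else if Even m ∧ 4 ≤ m then
        imagTimeWeight β M ^ (2 * (m / 2) - 1) * (crw * ccw ^ (2 * (m / 2) - 1) *
          (ρ⁻¹ ^ (2 * (m / 2)) * (Real.exp 1 * f) * (Real.exp 1 * αw * f / κ ^ 2) ^ (m / 2 - 2) / (1 - Real.exp 1 * αw * nV / κ ^ 2) ^ (m / 2)))
      else 0 := ⟨_, rfl⟩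
  have hNlit_two : Nlit 2 = imagTimeWeight β M ^ (2 - 1) * (crw * ccw ^ (2 - 1) * (ρ⁻¹ ^ 2 * (Real.exp 1 * nV) / (1 - Real.exp 1 * αw * nV / κ ^ 2))) := by
    rw [hNlit]; simp
  have hNlit_mul : ∀ p, 2 ≤ p → Nlit (2 * p) = imagTimeWeight β M ^ (2 * p - 1) * (crw * ccw ^ (2 * p - 1) *
      (ρ⁻¹ ^ (2 * p) * (Real.exp 1 * f) * (Real.exp 1 * αw * f / κ ^ 2) ^ (p - 2) / (1 - Real.exp 1 * αw * nV / κ ^ 2) ^ p)) := by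
    intro p hp
    have h2 : 2 * p ≠ 2 := by omega
    have hev : Even (2 * p) ∧ 4 ≤ 2 * p := ⟨even_two_mul p, by omega⟩
    rw [hNlit]
    simp only [h2, if_false, hev, and_self, if_true, Nat.mul_div_cancel_left p two_pos]
  have hnV0 : 0 ≤ nV := by
    rw [hnV]
    refine normV_nonneg hκ.le hρ.le (fun m' => ?_)
    split_ifs
    · exact mul_nonneg (by positivity) (sum_nonneg fun z _ => mul_nonneg (norm_nonneg _)
        (add_nonneg zero_le_one (by unfold torusSiteDist; exact Nat.cast_nonneg _)))
    · positivity
    · exact le_rfl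
  have hf0 : 0 ≤ f := by positivity
  have hNlit0 : ∀ m, 0 ≤ Nlit m := by
    intro m
    rw [hNlit]
    dsimp only
    split_ifs
    · positivity
    · positivity
    · exact le_rfl
  -- p3's step at `(n, J) := (j, j)`: every weighted pinned sum of `𝒱_j` at `F_j` is within the budget
  have hp3 := klWtPinnedSumAt_klEffectiveAction_fam_le_of_wgridStep hβ U μ K j j jw hκ hGB hαw hrow hcol hρ hθ hccw.le hrow' hcol'
    Nlit (fun m _ => hNlit0 m) (by rw [hNlit_two, hnV]) (fun p hp => by rw [hNlit_mul p hp, hnV])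
  -- the bi-graded reading of the budget in degree `2p ≥ 6`
  have hcg0 : 0 < cg := by rw [hcg]; positivity
  have hAg0 : 0 < Ag := by rw [hAg]; positivity
  have hPg0 : 0 ≤ Pg := by rw [hPg]; positivity
  have hbi : Nlit (2 * p) ≤ imagTimeWeight β M ^ (2 * p - 1) * Ag * Pg ^ p * |U| ^ (p - 1) := by
    have h := wgridBudget_bigraded_le (crw := crw) (θ := Real.exp 1 * αw * nV / κ ^ 2) hccw.le hρ hκ hαw hθ' hcF0 hfu (by omega : 2 ≤ p)
    rw [← hcg, ← hAg, ← hPg] at h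
    calc Nlit (2 * p) = imagTimeWeight β M ^ (2 * p - 1) * (crw * ccw ^ (2 * p - 1) *
          (ρ⁻¹ ^ (2 * p) * (Real.exp 1 * f) * (Real.exp 1 * αw * f / κ ^ 2) ^ (p - 2) / (1 - Real.exp 1 * αw * nV / κ ^ 2) ^ p)) :=
          hNlit_mul p (by omega)
      _ ≤ imagTimeWeight β M ^ (2 * p - 1) * (Ag * Pg ^ p * |U| ^ (p - 1)) := mul_le_mul_of_nonneg_left h (pow_nonneg hε _)
      _ = imagTimeWeight β M ^ (2 * p - 1) * Ag * Pg ^ p * |U| ^ (p - 1) := by ring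
  -- every levelled norm is below the budget
  have hlev' : klLevNormOf L M β μ K j (2 * p) (klEffectiveAction L M β U μ K klE0 j) Ωe ≤ Nlit (2 * p) :=
    klLevNormOf_le_of_wtPinned hβ.le μ K j jw (klEffectiveAction L M β U μ K klE0 j) (by omega) Ωe (hNlit0 _) (fun q w => hp3 (2 * p) q w)
  -- the unit law at `J = j`, with the regime discount `|U|^{p−1} ≤ λ^{p−1}/(B·Klam)²`
  have hu : 0 < klLevUnitF β M t p j := klLevUnitF_pos hβ t p j
  have hU0 : 0 ≤ |U| := abs_nonneg U
  have hAU : 0 ≤ Ag * |U| ^ (p - 1) := by positivity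
  have hunit : klLevNormOf L M β μ K j (2 * p) (klEffectiveAction L M β U μ K klE0 j) Ωe / klLevUnitF β M t p j ≤
      Auv * (B * epsCoupling P U j) ^ (p - 1) * Quv ^ p := by
    calc klLevNormOf L M β μ K j (2 * p) (klEffectiveAction L M β U μ K klE0 j) Ωe / klLevUnitF β M t p j
        ≤ imagTimeWeight β M ^ (2 * p - 1) * (Ag * |U| ^ (p - 1)) * Pg ^ p / klLevUnitF β M t p j := by
          refine div_le_div_of_nonneg_right ((hlev'.trans hbi).trans (le_of_eq (by ring))) hu.le
      _ ≤ ((2 : ℝ) ^ (7 * j) * (Ag * |U| ^ (p - 1)) * 1) * (1 : ℝ) ^ (p - 1) * (Pg / ((8 : ℝ) ^ j * 1)) ^ p :=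
          gridLaw_div_klLevUnitF_le hβ hAU hPg0 one_pos t (by omega) j
      _ = (2 : ℝ) ^ (7 * j) * Ag * (Pg / (8 : ℝ) ^ j) ^ p * |U| ^ (p - 1) := by rw [one_pow, mul_one, mul_one, mul_one]; ring
      _ ≤ (2 : ℝ) ^ (7 * j) * Ag * (Pg / (8 : ℝ) ^ j) ^ p * (lam ^ (p - 1) / (B * P.Klam) ^ 2) :=
          mul_le_mul_of_nonneg_left (pow_le_pow_div_sq hU0 hBK hle hp) (by positivity)
      _ = ((2 : ℝ) ^ (7 * j) * Ag / P.Klam ^ 2 / B ^ 2) * lam ^ (p - 1) * (Pg / (8 : ℝ) ^ j) ^ p := by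
          field_simp
      _ = Auv * (B * epsCoupling P U j) ^ (p - 1) * Quv ^ p := by rw [hAuv, hQuv]
  have hAuv0 : 0 ≤ Auv := by rw [hAuv]; positivity
  have hQuv0 : 0 ≤ Quv := by rw [hQuv]; positivity
  exact readoutLev_le_levelsRHS hβ hK0.le U hAuv0 hQuv0 hB hCE t (by omega) j hunit

/-! ## §2 The closer: `KernelNormsLevels` at level `j` straight from the grid step at `(Λ_j, F_j)` -/

/-- **`KernelNormsLevels` AT ANY LEVEL `j` FROM p3's WEIGHTED GRID STEP AT `(Λ_j, F_j)`** (RO-3's closer): the binders of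
`uvLevF_le_levelsRHS_of_wgridStep` with the threshold at the public constant `Qe.CE` give the registered clause `KernelNormsLevels L M P Qe β U μ K j` —
every prescription is read on the track `t = 4` (`levelGainExp 5 = 2 ≥ levelGainExp F`, `(2^j)⁻¹ ≤ 1`); no degree cap and no six-leg cell are needed.
[cite: BenfattoGiulianiMastropietro2006, §2.8 (2.83), §3 (3.2)-(3.8), Lemma 2.5 (2.98)] -/
theorem kernelNormsLevels_uvF_of_wgridStep {β : ℝ} (hβ : 0 < β) {P : SplitConsts} (hP : P.WF) (U : ℝ) (hU : 0 < U) (μ : ℝ) (K : TrigPolyC4v) (j : ℕ)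
    {B : ℝ} (hB : 1 ≤ B)
    -- p3's weighted grid step hypotheses at the cutoff `Λ_j`, analysis family `F_j`, rate `jw`
    (jw : ℕ) {κ : ℝ} (hκ : 0 < κ)
    (hGB : IsGramBoundedR ((hubbardGridSub L M β (2 * (2 * M))).transpose * hubbardCovAboveCT L M β μ 0 K (klScale klE0 j) *
      hubbardGridSub L M β (2 * (2 * M))) κ)
    {αw : ℝ} (hαw : 0 < αw)
    (hrow : ∀ X, ∑ Y, ‖((hubbardGridSub L M β (2 * (2 * M))).transpose * hubbardCovAboveCT L M β μ 0 K (klScale klE0 j) *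
      hubbardGridSub L M β (2 * (2 * M))) X Y‖ * gridLabelWt L (2 * (2 * M)) β {gridLegPos X, gridLegPos Y} ≤ αw)
    (hcol : ∀ Y, ∑ X, ‖((hubbardGridSub L M β (2 * (2 * M))).transpose * hubbardCovAboveCT L M β μ 0 K (klScale klE0 j) *
      hubbardGridSub L M β (2 * (2 * M))) X Y‖ * gridLabelWt L (2 * (2 * M)) β {gridLegPos X, gridLegPos Y} ≤ αw)
    {ρ : ℝ} (hρ : 0 < ρ)
    (hθ : Real.exp 1 * αw * normV (GridLeg (GridPoint L (2 * (2 * M)))) κ ρ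
      (fun m' : ℕ => if m' = 1 then |β| / (2 * (2 * M) : ℕ) * ∑ z : TorusSite 2 L, ‖framePosKernel L K z‖ * (1 + torusSiteDist z 0)
        else if m' = 2 then |U| * |β| / (2 * (2 * M) : ℕ) else 0) / κ ^ 2 < 1)
    {crw ccw : ℝ} (hcrw : 0 < crw) (hccw : 0 < ccw)
    (hrow' : ∀ X'' : SpaceTimeIdx L M × SectorLeg (sectorCount j), ∑ X' : GridLeg (GridPoint L (2 * (2 * M))),
      ‖(sectorAnalysisMatrix L M β (klAnisoFamily L M β μ K klE0 j) * hubbardGridSub L M β (2 * (2 * M))) X'' X'‖ *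
        gridLabelWt L (2 * (2 * M)) β {latticeLegPos (2 * (2 * M)) X'', gridLegPos X'} ≤ crw)
    (hcol' : ∀ X' : GridLeg (GridPoint L (2 * (2 * M))), ∑ X'' : SpaceTimeIdx L M × SectorLeg (sectorCount j),
      ‖(sectorAnalysisMatrix L M β (klAnisoFamily L M β μ K klE0 j) * hubbardGridSub L M β (2 * (2 * M))) X'' X'‖ *
        gridLabelWt L (2 * (2 * M)) β {latticeLegPos (2 * (2 * M)) X'', gridLegPos X'} ≤ ccw)
    -- the derived constants (equational binders)
    {nV cF cg Ag Pg : ℝ}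
    (hnV : nV = normV (GridLeg (GridPoint L (2 * (2 * M)))) κ ρ
      (fun m' : ℕ => if m' = 1 then |β| / (2 * (2 * M) : ℕ) * ∑ z : TorusSite 2 L, ‖framePosKernel L K z‖ * (1 + torusSiteDist z 0)
        else if m' = 2 then |U| * |β| / (2 * (2 * M) : ℕ) else 0))
    (hcF : cF = (Real.exp 2 * (κ + ρ)) ^ (2 * 2) * (|β| / (2 * (2 * M) : ℕ))) (hcg : cg = Real.exp 1 * αw * cF / κ ^ 2)
    (hAg : Ag = crw * Real.exp 1 * cF / (ccw * cg ^ 2)) (hPg : Pg = ccw ^ 2 * cg / (ρ ^ 2 * (1 - Real.exp 1 * αw * nV / κ ^ 2)))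
    -- the UV read-out constants (equational) and the threshold at the public constant
    {Auv Quv : ℝ} (hAuv : Auv = (2 : ℝ) ^ (7 * j) * Ag / P.Klam ^ 2 / B ^ 2) (hQuv : Quv = Pg / (8 : ℝ) ^ j)
    {Qe : EngConsts} (hCE : Quv * imagTimeWeight β M ^ 2 * B * max 1 (Auv / imagTimeWeight β M) ≤ Qe.CE) :
    KernelNormsLevels L M P Qe β U μ K j := by
  have hK1 : 1 ≤ P.Klam := hP.1
  have hθ' : Real.exp 1 * αw * nV / κ ^ 2 < 1 := by rw [hnV]; exact hθ
  have hcF0 : 0 ≤ cF := by rw [hcF]; positivity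
  have hcg0 : 0 ≤ cg := by rw [hcg]; positivity
  have hPg0 : 0 ≤ Pg := by
    rw [hPg]; exact div_nonneg (by positivity) (mul_nonneg (sq_nonneg _) (sub_nonneg.2 hθ'.le))
  have hQuv0 : 0 ≤ Quv := by rw [hQuv]; positivity
  have hB0 : 0 ≤ B := zero_le_one.trans hB
  have hCE0 : 0 ≤ Qe.CE := le_trans (mul_nonneg (by positivity) (zero_le_one.trans (le_max_left _ _))) hCE
  have hεj : 0 ≤ epsCoupling P U j := by unfold epsCoupling; positivity
  have h2j : ((2 : ℝ) ^ j)⁻¹ ≤ 1 := inv_le_one_of_one_le₀ (one_le_pow₀ (by norm_num))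
  have h5 : levelGainExp (((4 : Fin 5) : ℕ) + 1) = 2 := by decide
  intro p hp Ωe
  have h := uvLevF_le_levelsRHS_of_wgridStep hβ hP U hU μ K j hB jw hκ hGB hαw hrow hcol hρ hθ hcrw hccw hrow' hcol' hnV hcF hcg hAg hPg hAuv hQuv
    hCE (4 : Fin 5) hp Ωe
  rw [klLevNormOf_klEffectiveAction, h5] at h
  exact h.trans (mul_le_mul_of_nonneg_left (pow_le_pow_of_le_one (by positivity) h2j (levelGainExp_le_two _)) (by positivity))

end Summit.HubbardSuperconductivity.HubbardSuperconductivity.Theorems.EngineV8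

end
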